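import Summits.KontsevichZagierPeriods.KontsevichZagierPeriods.Theorems.GpcZeta4Eq4zeta31.Negative.Core

/-!
# `GpcZeta4Eq4zeta31` (stmt-KontsevichZagierPeriods-0275): negative side — toric normal form

Companion of `Negative/Core.lean` (cdisprove unit of the crux `GpcZeta4Eq4zeta31`, route
`Grothendieck`). **Every MZV word representation is ONE change of variables away from the
torus-invariant density on a rational polytope**: flipping the coordinates that carry the letter `1`
(`uᵢ = 1 − tᵢ` if `εᵢ = 1`, else `uᵢ = tᵢ`) is an affine involution `Φ_ε` with `|det Φ'_ε| = 1`,
carrying `[Δ_w, q·ω_ε]` to `[P_ε, q/(u₀⋯u_{w−1})]` with `P_ε = Φ_ε(Δ_w) = {1 > ũ₀ > ⋯ > ũ_{w−1} > 0}`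
(`ũᵢ = 1 − uᵢ` or `uᵢ`), an open rational polytope in the unit cube (`toric_mem_changeOfVariablesRel`,
generic in `w` and `ε`). So all word representations share ONE integrand — the Haar density of the torus
`(ℝ*)^w` — and differ only in their polytope. For the crux (`crux_iff_toric`):
`GpcZeta4Eq4zeta31 ⟺ [P_{0001}, μ] − [P_{0011}, 4μ] ∈ KZ.relations`, with
`P_{0001} = {1 > u₀ > u₁ > u₂ > 1 − u₃ > 0}` (`μ`-mass `ζ(4)`) and
`P_{0011} = {1 > u₀ > u₁ > 1 − u₂ > 1 − u₃ > 0}` (`μ`-mass `ζ(3,1)`), `μ = du/(u₀u₁u₂u₃)`. The open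
single-move question of `Subcalculi.lean` reads: is there a `ℚ`-semialgebraic bijection
`P_{0001} → P_{0011}` multiplying `μ` by exactly `4`?

Sources: M. Kontsevich, D. Zagier, *Periods* (2001), §1.1 (iterated-integral representation), §1.2
rule (2).
-/

noncomputable section

namespace Summit.KontsevichZagierPeriods.GpcZeta4Eq4zeta31.Negative

open Set MeasureTheory
open Literature.NumberTheory.Transcendental
open Literature.NumberTheory.Transcendental.KZ
open Summit.KontsevichZagierPeriods.KontsevichZagierPeriods.Theses.Grothendieck (GpcZeta4Eq4zeta31)
open Summit.KontsevichZagierPeriods.MzvKernelInKZ.Negative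

/-! ## Toric normal form: every word representation is ONE change of variables away from the
torus-invariant density `q · ∏ duᵢ/uᵢ` on a rational polytope

Flipping the coordinates that carry the letter `1` (`uᵢ = 1 − tᵢ` if `εᵢ = 1`, else `uᵢ = tᵢ`) is an
affine involution with `|det| = 1`; it carries `[Δ_w, q·ω_ε]` to `[P_ε, q/(u₀⋯u_{w−1})]`, where
`P_ε = Φ_ε(Δ_w)` is the open rational polytope `{1 > ũ₀ > ⋯ > ũ_{w−1} > 0}`, `ũᵢ = 1 − uᵢ` or `uᵢ`. So
ALL word representations share ONE integrand, the Haar density of the torus, and differ only in their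
polytope: MZV identities in the calculus are statements about the torus-invariant measure `μ` of
rational polytopes inside `(0,1)^w`. For the crux: `μ(P_{0001}) = 4·μ(P_{0011})` inside the calculus,
`P_{0001} = {1 > u₀ > u₁ > u₂ > 1 − u₃ > 0}`, `P_{0011} = {1 > u₀ > u₁ > 1 − u₂ > 1 − u₃ > 0}`
(`crux_iff_toric`). The OPEN single-move question of §4 becomes: is there a `ℚ`-semialgebraic bijection
`P_{0001} → P_{0011}` multiplying `μ` by exactly `4`? -/

section Toric

variable {w : ℕ}

/-- The flip `(Φ_ε u)ᵢ = 1 − uᵢ` if `εᵢ = 1`, else `uᵢ`. [folklore] -/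
def flipMap (ε : Fin w → Bool) (x : Fin w → ℝ) : Fin w → ℝ := fun i => if ε i then 1 - x i else x i

/-- `Φ_ε` on a coordinate. [folklore] -/
@[simp] theorem flipMap_apply (ε : Fin w → Bool) (x : Fin w → ℝ) (i : Fin w) :
    flipMap ε x i = if ε i then 1 - x i else x i := rfl

/-- The (constant, diagonal `±1`) derivative of `Φ_ε`. [folklore] -/
def flipLin (ε : Fin w → Bool) : (Fin w → ℝ) →L[ℝ] (Fin w → ℝ) :=
  ContinuousLinearMap.pi fun i => (if ε i then (-1 : ℝ) else 1) • ContinuousLinearMap.proj i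

/-- `Φ'_ε v i = ± v i`. [folklore] -/
@[simp] theorem flipLin_apply (ε : Fin w → Bool) (v : Fin w → ℝ) (i : Fin w) :
    flipLin ε v i = (if ε i then (-1 : ℝ) else 1) * v i := by
  simp only [flipLin, ContinuousLinearMap.pi_apply, FunLike.coe_smul, Pi.smul_apply,
    ContinuousLinearMap.proj_apply, smul_eq_mul]

/-- `Φ_ε` is an involution. [folklore] -/
theorem flipMap_flipMap (ε : Fin w → Bool) (x : Fin w → ℝ) : flipMap ε (flipMap ε x) = x := by
  funext i
  simp only [flipMap_apply]
  split_ifs <;> ring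

/-- `Φ_ε` is affine: `Φ_ε = Φ'_ε + ε` (the indicator vector of the letters `1`). [folklore] -/
theorem flipMap_eq_add (ε : Fin w → Bool) (x : Fin w → ℝ) :
    flipMap ε x = flipLin ε x + fun i => if ε i then (1 : ℝ) else 0 := by
  funext i
  simp only [flipMap_apply, Pi.add_apply, flipLin_apply]
  split_ifs <;> ring

/-- `Φ_ε` has derivative `Φ'_ε` everywhere. [folklore] -/
theorem hasFDerivAt_flipMap (ε : Fin w → Bool) (x : Fin w → ℝ) :
    HasFDerivAt (flipMap ε) (flipLin ε) x := by
  have : flipMap ε = fun x => flipLin ε x + fun i => if ε i then (1 : ℝ) else 0 :=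
    funext (flipMap_eq_add ε)
  rw [this]
  exact (flipLin ε).hasFDerivAt.add_const _

/-- `Φ'_ε ∘ Φ'_ε = id`, hence `|det Φ'_ε| = 1`. [folklore] -/
theorem abs_det_flipLin (ε : Fin w → Bool) : |(flipLin ε).det| = 1 := by
  have hcomp : (flipLin ε : (Fin w → ℝ) →ₗ[ℝ] (Fin w → ℝ)).comp
      (flipLin ε : (Fin w → ℝ) →ₗ[ℝ] (Fin w → ℝ)) = LinearMap.id := by
    apply LinearMap.ext
    intro v
    funext i
    simp only [LinearMap.coe_comp, ContinuousLinearMap.coe_coe, Function.comp_apply, flipLin_apply,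
      LinearMap.id_coe, id_eq]
    split_ifs <;> ring
  have h := congrArg LinearMap.det hcomp
  rw [LinearMap.det_comp, LinearMap.det_id] at h
  change |LinearMap.det (flipLin ε : (Fin w → ℝ) →ₗ[ℝ] (Fin w → ℝ))| = 1
  rcases mul_self_eq_one_iff.mp h with h1 | h1 <;> simp [h1]

/-- The TORIC DOMAIN `P_ε = Φ_ε⁻¹(Δ_w) = Φ_ε(Δ_w)`: the open rational polytope
`{1 > ũ₀ > ⋯ > ũ_{w−1} > 0}`, `ũᵢ = 1 − uᵢ` (`εᵢ = 1`) or `uᵢ`. [folklore] -/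
def toricDomain (ε : Fin w → Bool) : Set (Fin w → ℝ) := flipMap ε ⁻¹' simplex w

/-- `Φ_ε(Δ_w) = P_ε` (involution). [folklore] -/
theorem image_flipMap_simplex (ε : Fin w → Bool) : flipMap ε '' simplex w = toricDomain ε := by
  ext y
  constructor
  · rintro ⟨x, hx, rfl⟩
    show flipMap ε (flipMap ε x) ∈ simplex w
    rwa [flipMap_flipMap]
  · intro hy
    exact ⟨flipMap ε y, hy, flipMap_flipMap ε y⟩

/-- `Φ_ε` is injective (on anything). [folklore] -/
theorem injOn_flipMap (ε : Fin w → Bool) (s : Set (Fin w → ℝ)) : InjOn (flipMap ε) s := by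
  intro x _ y _ h
  rw [← flipMap_flipMap ε x, ← flipMap_flipMap ε y, h]

/-- `Φ_ε` is a polynomial map over `ℚ`. [folklore] -/
theorem flipMap_eq_aeval (ε : Fin w → Bool) (x : Fin w → ℝ) :
    flipMap ε x = fun j => MvPolynomial.aeval x (if ε j then 1 - MvPolynomial.X j else MvPolynomial.X j :
      MvPolynomial (Fin w) ℚ) := by
  funext j
  simp only [flipMap_apply]
  split_ifs <;> simp

/-- `P_ε` is `ℚ`-semialgebraic (preimage of the simplex under a polynomial map). [folklore] -/
theorem isSemialgebraic_toricDomain (ε : Fin w → Bool) :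
    Literature.ModelTheory.ExponentialFields.IsSemialgebraic ℚ (toricDomain ε) := by
  have h := Literature.ModelTheory.ExponentialFields.IsSemialgebraic.preimage_aeval (R := ℝ)
    (fun j : Fin w => (if ε j then 1 - MvPolynomial.X j else MvPolynomial.X j : MvPolynomial (Fin w) ℚ))
    (KZ.isSemialgebraic_openOrderedSimplex w)
  convert h using 1
  ext x
  simp only [toricDomain, mem_preimage, flipMap_eq_aeval]
  rfl

/-- `Φ_ε` is a `ℚ`-semialgebraic map on the simplex. [folklore] -/
theorem isSemialgebraicMapOn_flipMap (ε : Fin w → Bool) : IsSemialgebraicMapOn ℚ (simplex w) (flipMap ε) := by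
  have h := isSemialgebraicMapOn_aeval (KZ.isSemialgebraic_openOrderedSimplex w)
    (fun j : Fin w => (if ε j then 1 - MvPolynomial.X j else MvPolynomial.X j : MvPolynomial (Fin w) ℚ))
  exact h.congr fun x _ => (flipMap_eq_aeval ε x).symm

/-- `P_ε` lies in the open unit cube. [folklore] -/
theorem toricDomain_subset_cube (ε : Fin w → Bool) {u : Fin w → ℝ} (hu : u ∈ toricDomain ε) (i : Fin w) :
    0 < u i ∧ u i < 1 := by
  obtain ⟨h0, h1, -⟩ := hu
  have a := h0 i
  have b := h1 i
  simp only [flipMap_apply] at a b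
  split_ifs at a b with h
  · exact ⟨by linarith, by linarith⟩
  · exact ⟨a, b⟩

/-- **The torus density pulls back to the word integrand**: `(q/∏uᵢ) ∘ Φ_ε = q·ω_ε`. [folklore] -/
theorem wordFun_zero_flipMap (ε : Fin w → Bool) (q : ℚ) (x : Fin w → ℝ) :
    wordFun (fun _ => false) q (flipMap ε x) = wordFun ε q x := by
  simp only [wordFun, flipMap_apply, Bool.false_eq_true, if_false]
  congr 1
  refine Finset.prod_congr rfl fun i _ => ?_
  cases ε i <;> simp

/-- The torus density `q/(u₀⋯u_{w−1})` is `ℚ`-semialgebraic on `P_ε`. [folklore] -/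
theorem isSemialgebraicFunOn_toric (ε : Fin w → Bool) (q : ℚ) :
    IsSemialgebraicFunOn ℚ (toricDomain ε) (wordFun (fun _ => false) q) := by
  have hq : ∀ u ∈ toricDomain ε, MvPolynomial.aeval u
      (∏ i : Fin w, (if (fun _ : Fin w => false) i then 1 - MvPolynomial.X i else MvPolynomial.X i :
        MvPolynomial (Fin w) ℚ)) ≠ 0 := by
    intro u hu
    rw [map_prod]
    refine Finset.prod_ne_zero_iff.mpr fun i _ => ?_
    simpa using (toricDomain_subset_cube ε hu i).1.ne'
  refine (isSemialgebraicFunOn_aeval_div_aeval (isSemialgebraic_toricDomain ε) (MvPolynomial.C q) _ hq).congr ?_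
  intro u _
  exact (wordFun_eq_aeval_div _ q u).symm

/-- The torus density is absolutely integrable on `P_ε` for admissible `ε` (transport of
`integrableOn_wordFun` along `Φ_ε`). [folklore] -/
theorem integrableOn_toric {ε : Fin w → Bool} (hε : Adm ε) (q : ℚ) :
    IntegrableOn (wordFun (fun _ => false) q) (toricDomain ε) volume := by
  rw [← image_flipMap_simplex]
  refine (integrableOn_image_iff_integrableOn_abs_det_fderiv_smul volume
    (KZ.measurableSet_openOrderedSimplex w) (fun x _ => (hasFDerivAt_flipMap ε x).hasFDerivWithinAt)
    (injOn_flipMap ε _) (wordFun (fun _ => false) q)).2 ?_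
  simp only [abs_det_flipLin, one_smul, wordFun_zero_flipMap]
  exact integrableOn_wordFun hε q

/-- **The toric representation** `[P_ε, q/(u₀⋯u_{w−1})]`. [folklore] -/
def toricRep (ε : Fin w → Bool) (q : ℚ) (hε : Adm ε) : IntegralRep w where
  domain := toricDomain ε
  integrand := wordFun (fun _ => false) q
  isSemialgebraic_domain := isSemialgebraic_toricDomain ε
  isSemialgebraicFunOn_integrand := isSemialgebraicFunOn_toric ε q
  integrableOn := integrableOn_toric hε q

/-- Domain of the toric representation. [folklore] -/
@[simp] theorem toricRep_domain (ε : Fin w → Bool) (q : ℚ) (hε : Adm ε) :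
    (toricRep ε q hε).domain = toricDomain ε := rfl

/-- Integrand of the toric representation. [folklore] -/
@[simp] theorem toricRep_integrand (ε : Fin w → Bool) (q : ℚ) (hε : Adm ε) :
    (toricRep ε q hε).integrand = wordFun (fun _ => false) q := rfl

/-- **TORIC NORMAL FORM IS ONE CHANGE-OF-VARIABLES MOVE**: `[Δ_w, q·ω_ε] − [P_ε, q/∏uᵢ] ∈
changeOfVariablesRel`. [folklore] -/
theorem toric_mem_changeOfVariablesRel (ε : Fin w → Bool) (q : ℚ) (hε : Adm ε) :
    of (wordRep ε q hε) - of (toricRep ε q hε) ∈ changeOfVariablesRel :=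
  ⟨w, wordRep ε q hε, toricRep ε q hε, flipMap ε, fun _ => flipLin ε,
    isSemialgebraicMapOn_flipMap ε,
    fun x _ => (hasFDerivAt_flipMap ε x).hasFDerivWithinAt,
    injOn_flipMap ε _,
    (image_flipMap_simplex ε).symm,
    fun x _ => by rw [wordRep_integrand, toricRep_integrand, abs_det_flipLin, mul_one, wordFun_zero_flipMap],
    rfl⟩

/-- Hence `[Δ_w, q·ω_ε] ≡ [P_ε, q/∏uᵢ]` modulo relations. [folklore] -/
theorem toric_mem_relations (ε : Fin w → Bool) (q : ℚ) (hε : Adm ε) :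
    of (wordRep ε q hε) - of (toricRep ε q hε) ∈ relations :=
  changeOfVariablesRel_subset_relations (toric_mem_changeOfVariablesRel ε q hε)

end Toric

/-- The toric polytope of `ζ(4)`: `P_{0001} = {1 > u₀ > u₁ > u₂ > 1 − u₃ > 0}`. [folklore] -/
theorem toricDomain_ω4 :
    toricDomain ω4 = {u : Fin 4 → ℝ | 1 > u 0 ∧ u 0 > u 1 ∧ u 1 > u 2 ∧ u 2 > 1 - u 3 ∧ 1 - u 3 > 0} := by
  rw [toricDomain, ← simplex4_eq]
  ext u
  simp [ω4, flipMap]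

/-- The toric polytope of `ζ(3,1)`: `P_{0011} = {1 > u₀ > u₁ > 1 − u₂ > 1 − u₃ > 0}`. [folklore] -/
theorem toricDomain_ω31 :
    toricDomain ω31 =
      {u : Fin 4 → ℝ | 1 > u 0 ∧ u 0 > u 1 ∧ u 1 > 1 - u 2 ∧ 1 - u 2 > 1 - u 3 ∧ 1 - u 3 > 0} := by
  rw [toricDomain, ← simplex4_eq]
  ext u
  simp [ω31, flipMap]

/-- The common integrand in toric form is literally `q/(u₀u₁u₂u₃)`. [folklore] -/
theorem wordFun_zero_four (q : ℚ) (u : Fin 4 → ℝ) :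
    wordFun (fun _ : Fin 4 => false) q u = q / (u 0 * u 1 * u 2 * u 3) := by
  simp only [wordFun, Bool.false_eq_true, if_false, Fin.prod_univ_four, div_eq_mul_inv, mul_inv, one_mul]

/-- **THE CRUX IN TORIC NORMAL FORM**: `μ(P_{0001}) = 4·μ(P_{0011})` inside the calculus, `μ` the Haar
density `du/(u₀u₁u₂u₃)` — one integrand, two rational polytopes. [folklore] -/
theorem crux_iff_toric :
    GpcZeta4Eq4zeta31 ↔ of (toricRep ω4 1 adm_ω4) - of (toricRep ω31 4 adm_ω31) ∈ relations := by
  rw [crux_iff_target, cFds4_eq]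
  have h1 := toric_mem_relations ω4 1 adm_ω4
  have h2 := toric_mem_relations ω31 4 adm_ω31
  constructor
  · intro h
    have e : of (toricRep ω4 1 adm_ω4) - of (toricRep ω31 4 adm_ω31) =
        (of (wordRep ω4 1 adm_ω4) - of (wordRep ω31 4 adm_ω31)) - (of (wordRep ω4 1 adm_ω4) -
          of (toricRep ω4 1 adm_ω4)) + (of (wordRep ω31 4 adm_ω31) - of (toricRep ω31 4 adm_ω31)) := by
      abel
    rw [e]
    exact relations.add_mem (relations.sub_mem h h1) h2
  · intro h
    have e : of (wordRep ω4 1 adm_ω4) - of (wordRep ω31 4 adm_ω31) =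
        (of (toricRep ω4 1 adm_ω4) - of (toricRep ω31 4 adm_ω31)) + (of (wordRep ω4 1 adm_ω4) -
          of (toricRep ω4 1 adm_ω4)) - (of (wordRep ω31 4 adm_ω31) - of (toricRep ω31 4 adm_ω31)) := by
      abel
    rw [e]
    exact relations.sub_mem (relations.add_mem h h1) h2

end Summit.KontsevichZagierPeriods.GpcZeta4Eq4zeta31.Negative
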